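import Summits.BirchSwinnertonDyer.BirchSwinnertonDyer.Theorems.ManinLocalTwoThreeTameThreeNeronScalarIII
import Summits.BirchSwinnertonDyer.BirchSwinnertonDyer.Theorems.ManinLocalTwoThreeThreeTorsionIntegralAtThree
import HarnessLib

/-!
# NB₃ on the `III` and `III*` strata, unconditionally: a tame type-`III` curve has NO `3`-blind rational `3`-torsion point,
# and a tame potentially-good type-`III*` curve has no rational `3`-torsion point at all

Summit `BirchSwinnertonDyer`, route `ManinLocalTwoThree` (cell bsd-f2-manin), crux C3 `ManinPrimeToThreeAtNine`
(stmt-BirchSwinnertonDyer-22968), line `kato_shift_three`, stub NB₃ `NoBlindThreeTorsionOptimal` (tree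
`Rank1Residual/ManinAdditive/CuspidalKummerCubeNoBlindLaws.lean`): «no `X₀`-optimal `W` with `9 ∣ N` carries a `3`-BLIND
rational `3`-torsion point».  The an planner localised NB₃ on the tame band to the Kodaira POSITION LAW T3III plus local
laws (MEMO-an §66, `noBlindTame_of_positionLaw`).  THIS FILE settles the two local strata where Tate + Vélu decide everything,
with NO optimality and NO modularity hypothesis:

* `not_isShortThreeTorsion_of_IIIstar` — on a globally minimal `W` with `9 ∥ N`, `ord₃ Δ_min = 9`, `ord₃ j ≥ 0` (pot.-good
  `III*`) the intrinsic model `E♮ = E_{W,1}` has NO rational point of order `3`: by p642603's root analysis a rational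
  `3`-line has abscissa `X₁ = 9σ/4`, and then `64·Y₁² = 27·M` with `3 ∤ M` — odd `3`-adic valuation.  (NB₃ is vacuous there;
  this is the torsion half of an's E-an-114 with optimality dropped.)
* `not_threeBlind_of_III` — on a globally minimal `W` with `9 ∥ N`, `ord₃ Δ_min = 3` (type `III`) NO rational point `(X₁, Y₁)`
  of order `3` of `E♮` is `3`-blind: p643391's root analysis gives `X₁ = 3σ/4`, `64Y₁² = M ≡ 2β (mod 3)`, so `β ≡ 2 (mod 3)`
  (`Y₁ ∈ ℚ`), and then the lead's `z³`-certificate quantity `(Y₁ − α/3)/3 = N′/(192·Y₁)` has `3 ∤ N′`: `ord₃ = −1`,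
  `‖·‖₃ = 3 > 1`, so `not_threeBlind_of_residue_certificate` (p1) fires.  (an's reading «on `III` a rational `3`-torsion point is
  automatically non-blind», E-an-107 ∧ E-an-115 on that stratum, now a theorem.)
* `noBlindThreeTorsion_of_III_or_IIIstar` — NB₃'s body on both strata (`ord₃ Δ_min = 3`, or `= 9` with `ord₃ j ≥ 0`), for
  EVERY globally minimal tame `W` (no datum, no optimality).

So on the tame band NB₃ is reduced to the `I₀*`/`Iₙ*` strata (an's position law E-an-113).  HONEST FRAMING: NB₃, C3, Manin's
conjecture and BSD are not proved.  No definitions, no named facts, no sorry.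

References: [SilvermanATAEC1994] IV.9.4 Table 4.1; [SilvermanAEC2009] III.1, VII.3; cell memos HOME/MEMO-an.md §64–§66,
HOME/p1/NB3-memo-p1-g5.md (census: blind points never on optimal curves, `N < 5·10⁵`).
-/

set_option linter.dupNamespace false
set_option autoImplicit false

noncomputable section

open scoped Classical

open WeierstrassCurve IsDedekindDomain NumberField Rat.HeightOneSpectrum Polynomial
  Literature.NumberTheory.DiophantineGeometry Literature.NumberTheory.EllipticCurves
  Summit.BirchSwinnertonDyer.Rank1Residual.Additive
  Summit.BirchSwinnertonDyer.Rank1Residual.ManinAdditive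
  Summit.BirchSwinnertonDyer.Rank1Residual.ManinAdditive.CuspidalKummer
  Summit.BirchSwinnertonDyer.Rank1Residual.ManinAdditive.CuspidalKummerThree

namespace Summit.BirchSwinnertonDyer.BirchSwinnertonDyer.Theorems.ManinLocalTwoThree

/-! ### §0 Small `3`-adic helpers -/

/-- `ord₃ 64 = 0`, `ord₃ 192 = 1`, `ord₃ 27 = 3` (as rationals). [elementary] -/
private theorem padicValRat_three_consts :
    padicValRat 3 (64 : ℚ) = 0 ∧ padicValRat 3 (192 : ℚ) = 1 ∧ padicValRat 3 (27 : ℚ) = 3 := by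
  have h3 : padicValRat 3 (3 : ℚ) = 1 := by exact_mod_cast padicValRat.self (p := 3) (by norm_num)
  have h64 : padicValRat 3 (64 : ℚ) = 0 := by
    rw [show (64 : ℚ) = ((64 : ℕ) : ℚ) by norm_num, padicValRat.of_nat]
    norm_cast; exact padicValNat.eq_zero_of_not_dvd (by norm_num)
  refine ⟨h64, ?_, ?_⟩
  · rw [show (192 : ℚ) = 3 * 64 by norm_num, padicValRat.mul (by norm_num) (by norm_num), h3, h64]; simp
  · rw [show (27 : ℚ) = 3 ^ 3 by norm_num, padicValRat.pow (3 : ℚ), h3]; simp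

/-- An integer over a denominator prime to `3` is `3`-integral in `ℚ₃`. [folklore] -/
private theorem norm_intCast_div_le_one (n m : ℤ) (hm : ¬ (3 : ℤ) ∣ m) :
    ‖(((n : ℚ) / m : ℚ) : ℚ_[3])‖ ≤ 1 := by
  have hmn : ‖((m : ℚ) : ℚ_[3])‖ = 1 := by
    rw [Rat.cast_intCast]
    exact le_antisymm (Padic.norm_int_le_one m) (not_lt.mp fun h ↦ hm (Padic.norm_intCast_lt_one_iff.mp h))
  rw [Rat.cast_div, norm_div, hmn, div_one, Rat.cast_intCast]
  exact Padic.norm_int_le_one n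

/-! ### §1 `III*`: no rational `3`-torsion -/

/-- **A tame potentially-good `III*` curve has no rational point of order `3` on its intrinsic model** (`W` globally minimal,
`9 ∥ N`, `ord₃ Δ_min = 9`, `ord₃ j ≥ 0`): the abscissa of a rational `3`-line is `X₁ = 9σ/4` (p642603), and then
`64·Y₁² = 27·M`, `3 ∤ M`, has odd valuation.  NB₃ is vacuous on this stratum.  [cite: SilvermanATAEC1994, IV.9.4 Table 4.1] -/
theorem not_isShortThreeTorsion_of_IIIstar (W : WeierstrassCurve ℚ) [W.IsElliptic] [W.IsGloballyMinimal]
    (h9 : 3 ^ 2 ∣ W.conductorNorm ℤ) (h27 : ¬ 3 ^ 3 ∣ W.conductorNorm ℤ)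
    (hΔ : padicValInt 3 W.minimalDiscriminantInt = 9) (hj : 0 ≤ padicValRat 3 W.j) (X₁ Y₁ : ℚ) :
    ¬ IsShortThreeTorsion W 1 X₁ Y₁ := by
  intro hT
  obtain ⟨r, β, γ, δ, ε, hγ, hε, hb₂, hb₄, hb₆, hb₈⟩ := exists_IIIstarShape_coeffs_three W h9 h27 hΔ hj
  have hc₄ : W.c₄ = 81 * ((β : ℚ) ^ 2 - 8 * γ) := by
    simp only [WeierstrassCurve.c₄]; rw [hb₂, hb₄]; ring
  have hc₆ : W.c₆ = -729 * ((β : ℚ) ^ 3 - 12 * β * γ + 72 * δ) := by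
    simp only [WeierstrassCurve.c₆]; rw [hb₂, hb₄, hb₆]; ring
  have ha₄ : (shortModel W 1).a₄ = -27 * ((β : ℚ) ^ 2 - 8 * γ) / 16 := by
    show -((1 : ℤ) ^ 4 * W.c₄ / 48 : ℚ) = _; rw [hc₄]; push_cast; ring
  have ha₆ : (shortModel W 1).a₆ = 27 * ((β : ℚ) ^ 3 - 12 * β * γ + 72 * δ) / 32 := by
    show -((1 : ℤ) ^ 6 * W.c₆ / 864 : ℚ) = _; rw [hc₆]; push_cast; ring
  -- the root
  have hroot := (isRoot_Ψ₃_shortModel_iff W 1 X₁).mp hT.2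
  rw [ha₄, ha₆] at hroot
  have hε' : (4 * ε : ℚ) = 3 * β * δ - γ ^ 2 := by exact_mod_cast hε
  have hy : (4 * X₁ - 3 * β) ^ 4 + 12 * β * (4 * X₁ - 3 * β) ^ 3 + 432 * γ * (4 * X₁ - 3 * β) ^ 2 +
      15552 * δ * (4 * X₁ - 3 * β) + 62208 * ε = 0 := by
    linear_combination (256 / 3 : ℚ) * hroot + 15552 * hε'
  obtain ⟨z, σ, hyz, hσ, hz3, -⟩ := exists_int_of_psi3IIIstar_root hγ hε hy
  have hσ' : ((z + β : ℤ) : ℚ) = 3 * σ := by exact_mod_cast hσ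
  push_cast at hσ'
  have hX : X₁ = 9 * (σ : ℚ) / 4 := by linear_combination hyz / 4 + 3 * hσ' / 4
  have hβ3 : ¬ (3 : ℤ) ∣ β := by
    rintro ⟨k, hk⟩
    exact hz3 ⟨σ - k, by linear_combination hσ - hk⟩
  -- the ordinate
  have heq := equation_of_isShortThreeTorsion hT
  rw [ha₄, ha₆, hX] at heq
  set M : ℤ := 27 * σ ^ 3 - 9 * σ * (β ^ 2 - 8 * γ) + 2 * (β ^ 3 - 12 * β * γ + 72 * δ) with hM
  have h64 : Y₁ ^ 2 = 27 * (M : ℚ) / 64 := by rw [hM]; push_cast; linear_combination heq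
  have hM3 : ¬ (3 : ℤ) ∣ M := by
    rintro ⟨k, hk⟩
    apply hβ3
    refine Int.prime_three.dvd_of_dvd_pow (n := 3) ?_
    have : (2 : ℤ) * β ^ 3 = 3 * (k - (9 * σ ^ 3 - 3 * σ * (β ^ 2 - 8 * γ) - 8 * β * γ + 48 * δ)) := by
      linear_combination hk
    exact (Int.prime_three.dvd_or_dvd ⟨_, this⟩).resolve_left (by norm_num)
  have hY0 : Y₁ ≠ 0 := y_ne_zero_of_isShortThreeTorsion hT
  have hM0 : (M : ℚ) ≠ 0 := by
    have : M ≠ 0 := fun h ↦ hM3 (h ▸ dvd_zero 3); exact_mod_cast this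
  obtain ⟨h64v, -, h27v⟩ := padicValRat_three_consts
  have hv := congrArg (padicValRat 3) h64
  rw [padicValRat.pow Y₁, padicValRat.div (mul_ne_zero (by norm_num) hM0) (by norm_num),
    padicValRat.mul (by norm_num) hM0, h27v, h64v, padicValRat.of_int, padicValInt.eq_zero_of_not_dvd hM3] at hv
  push_cast at hv
  omega

/-! ### §2 `III`: no blind rational `3`-torsion -/

/-- `64t² = 2b³ + 3k` in `ZMod 3` with `b ≠ 0` forces `b = 2` (squares are `0, 1`). -/
private theorem zmod3_sq_decide : ∀ t b k : ZMod 3, b ≠ 0 → 64 * t ^ 2 = 2 * b ^ 3 + 3 * k → b = 2 := by decide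

/-- With `b = 2`, `g ≠ 0`: `2b³ + 2b² − 16g + 3k ≠ 0` in `ZMod 3`. -/
private theorem zmod3_cert_decide : ∀ b g k : ZMod 3, b = 2 → g ≠ 0 → 2 * b ^ 3 + 2 * b ^ 2 - 16 * g + 3 * k ≠ 0 := by
  decide

/-- **A tame `III` curve has no `3`-blind rational point of order `3` on its intrinsic model** (`W` globally minimal,
`9 ∥ N`, `ord₃ Δ_min = 3`; no datum, no optimality): with p643391's root analysis `X₁ = 3σ/4`, `64Y₁² = M ≡ 2β (mod 3)` forces
`β ≡ 2 (mod 3)`, and the lead's `z³` certificate quantity `(Y₁ − α/3)/3 = N′/(192Y₁)` has `3 ∤ N′`, i.e. `3`-adic norm `3 > 1`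
(`not_threeBlind_of_residue_certificate`).  [cite: SilvermanATAEC1994, IV.9.4 Table 4.1] [cite: SilvermanAEC2009, IV.1] -/
theorem not_threeBlind_of_III (W : WeierstrassCurve ℚ) [W.IsElliptic] [W.IsGloballyMinimal]
    (h9 : 3 ^ 2 ∣ W.conductorNorm ℤ) (h27 : ¬ 3 ^ 3 ∣ W.conductorNorm ℤ)
    (hΔ : padicValInt 3 W.minimalDiscriminantInt = 3) {X₁ Y₁ : ℚ} (hT : IsShortThreeTorsion W 1 X₁ Y₁) :
    ¬ ThreeBlind W X₁ Y₁ := by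
  obtain ⟨r, β, γ, δ, ε, hε3, hb₂, hb₄, hb₆, hb₈⟩ := exists_IIIShape_coeffs_three W h9 h27 hΔ
  have hε : 4 * ε = 3 * β * δ - γ ^ 2 := by
    have h := W.b_relation
    rw [hb₂, hb₄, hb₆, hb₈] at h
    have h' : ((4 * ε : ℤ) : ℚ) = ((3 * β * δ - γ ^ 2 : ℤ) : ℚ) := by push_cast; linear_combination h / 9
    exact_mod_cast h'
  have hγ3 : ¬ (3 : ℤ) ∣ γ := by
    rintro ⟨k, hk⟩
    apply hε3
    have : 4 * ε = 3 * (β * δ - 3 * k ^ 2) := by rw [hε, hk]; ring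
    exact (Int.prime_three.dvd_or_dvd ⟨_, this⟩).resolve_left (by norm_num)
  have hc₄ : W.c₄ = 9 * ((β : ℚ) ^ 2 - 8 * γ) := by
    simp only [WeierstrassCurve.c₄]; rw [hb₂, hb₄]; ring
  have hc₆ : W.c₆ = -27 * ((β : ℚ) ^ 3 - 12 * β * γ + 72 * δ) := by
    simp only [WeierstrassCurve.c₆]; rw [hb₂, hb₄, hb₆]; ring
  have ha₄ : (shortModel W 1).a₄ = -3 * ((β : ℚ) ^ 2 - 8 * γ) / 16 := by
    show -((1 : ℤ) ^ 4 * W.c₄ / 48 : ℚ) = _; rw [hc₄]; push_cast; ring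
  have ha₆ : (shortModel W 1).a₆ = ((β : ℚ) ^ 3 - 12 * β * γ + 72 * δ) / 32 := by
    show -((1 : ℤ) ^ 6 * W.c₆ / 864 : ℚ) = _; rw [hc₆]; push_cast; ring
  -- `3`-integrality of `E♮` and of the point
  have hA : ‖(((shortModel W 1).a₄ : ℚ) : ℚ_[3])‖ ≤ 1 := by
    rw [ha₄, show (-3 * ((β : ℚ) ^ 2 - 8 * γ) / 16 : ℚ) = ((-3 * (β ^ 2 - 8 * γ) : ℤ) : ℚ) / (16 : ℤ) by push_cast; ring]
    exact norm_intCast_div_le_one _ 16 (by norm_num)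
  have hB : ‖(((shortModel W 1).a₆ : ℚ) : ℚ_[3])‖ ≤ 1 := by
    rw [ha₆, show (((β : ℚ) ^ 3 - 12 * β * γ + 72 * δ) / 32 : ℚ) = ((β ^ 3 - 12 * β * γ + 72 * δ : ℤ) : ℚ) / (32 : ℤ) by
      push_cast; ring]
    exact norm_intCast_div_le_one _ 32 (by norm_num)
  obtain ⟨hXn, hYn⟩ := norm_le_one_of_isShortThreeTorsion W hA hB hT
  -- the root
  have hroot := (isRoot_Ψ₃_shortModel_iff W 1 X₁).mp hT.2
  rw [ha₄, ha₆] at hroot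
  have hε' : (4 * ε : ℚ) = 3 * β * δ - γ ^ 2 := by exact_mod_cast hε
  have hy : (4 * X₁ - β) ^ 4 + 4 * β * (4 * X₁ - β) ^ 3 + 48 * γ * (4 * X₁ - β) ^ 2 +
      576 * δ * (4 * X₁ - β) + 768 * ε = 0 := by
    linear_combination (256 / 3 : ℚ) * hroot + 192 * hε'
  obtain ⟨Y, σ, hyY, hσ, hY3, -⟩ := exists_int_of_tameQuartic_root hε3 hy
  have hσ' : ((Y + β : ℤ) : ℚ) = 3 * σ := by exact_mod_cast hσ
  push_cast at hσ'
  have hX : X₁ = 3 * (σ : ℚ) / 4 := by linear_combination hyY / 4 + hσ' / 4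
  have hβ3 : ¬ (3 : ℤ) ∣ β := by
    rintro ⟨k, hk⟩
    exact hY3 ⟨σ - k, by linear_combination hσ - hk⟩
  -- the ordinate: `64 Y₁² = M`
  have heq := equation_of_isShortThreeTorsion hT
  rw [ha₄, ha₆, hX] at heq
  set M : ℤ := 27 * σ ^ 3 - 9 * σ * (β ^ 2 - 8 * γ) + 2 * (β ^ 3 - 12 * β * γ + 72 * δ) with hM
  have h64 : 64 * Y₁ ^ 2 = (M : ℚ) := by rw [hM]; push_cast; linear_combination 64 * heq
  -- `β ≡ 2 (mod 3)` from `Y₁ ∈ ℤ₃`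
  set yz : ℤ_[3] := ⟨((Y₁ : ℚ) : ℚ_[3]), hYn⟩ with hyz
  have h64z : (64 : ℤ_[3]) * yz ^ 2 = (2 * β ^ 3 + 3 * (9 * σ ^ 3 - 3 * σ * (β ^ 2 - 8 * γ) - 8 * β * γ + 48 * δ) : ℤ) := by
    apply PadicInt.ext
    have h64c : ((64 : ℤ_[3]) : ℚ_[3]) = 64 := by exact_mod_cast PadicInt.coe_natCast 64
    rw [PadicInt.coe_mul, PadicInt.coe_pow, h64c, PadicInt.coe_intCast]
    have hyzc : ((yz : ℤ_[3]) : ℚ_[3]) = ((Y₁ : ℚ) : ℚ_[3]) := rfl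
    rw [hyzc]
    have h := congrArg (fun x : ℚ ↦ ((x : ℚ) : ℚ_[3])) h64
    simp only [Rat.cast_mul, Rat.cast_pow, Rat.cast_ofNat, Rat.cast_intCast] at h
    rw [h, hM]; push_cast; ring
  have hb2 : ((β : ℤ) : ZMod 3) = 2 := by
    have h := congrArg (PadicInt.toZMod (p := 3)) h64z
    rw [map_mul, map_pow, map_ofNat, map_intCast] at h
    simp only [Int.cast_add, Int.cast_mul, Int.cast_pow, Int.cast_sub, Int.cast_ofNat] at h
    exact zmod3_sq_decide (PadicInt.toZMod yz) (β : ZMod 3) _ (by rwa [Ne, ZMod.intCast_zmod_eq_zero_iff_dvd]) h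
  -- the certificate quantity `(Y₁ − α/3)/3 = N' / (192 Y₁)`
  set N' : ℤ := M - 18 * σ ^ 2 + 2 * β ^ 2 - 16 * γ with hN'
  have hN'3 : ¬ (3 : ℤ) ∣ N' := by
    intro h3
    have h := (ZMod.intCast_zmod_eq_zero_iff_dvd N' 3).mpr h3
    have e : N' = 2 * β ^ 3 + 2 * β ^ 2 - 16 * γ +
        3 * (9 * σ ^ 3 - 3 * σ * (β ^ 2 - 8 * γ) - 8 * β * γ + 48 * δ - 6 * σ ^ 2) := by rw [hN', hM]; ring
    rw [e] at h
    simp only [Int.cast_add, Int.cast_mul, Int.cast_pow, Int.cast_sub, Int.cast_ofNat] at h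
    exact zmod3_cert_decide (β : ZMod 3) γ _ hb2 (by rwa [Ne, ZMod.intCast_zmod_eq_zero_iff_dvd]) h
  have hY0 : Y₁ ≠ 0 := y_ne_zero_of_isShortThreeTorsion hT
  have hQ : (Y₁ - tangentSlope W 1 X₁ Y₁ / 3) / 3 = (N' : ℚ) / (192 * Y₁) := by
    simp only [tangentSlope]
    rw [ha₄, hX, hN']
    push_cast
    field_simp
    linear_combination (1536 : ℚ) * h64
  -- its `3`-adic norm is `3 > 1`
  have hN'0 : (N' : ℚ) ≠ 0 := by
    have : N' ≠ 0 := fun h ↦ hN'3 (h ▸ dvd_zero 3); exact_mod_cast this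
  have hM3 : ¬ (3 : ℤ) ∣ M := by
    rintro ⟨k, hk⟩
    apply hβ3
    refine Int.prime_three.dvd_of_dvd_pow (n := 3) ?_
    have : (2 : ℤ) * β ^ 3 = 3 * (k - (9 * σ ^ 3 - 3 * σ * (β ^ 2 - 8 * γ) - 8 * β * γ + 48 * δ)) := by
      linear_combination hk
    exact (Int.prime_three.dvd_or_dvd ⟨_, this⟩).resolve_left (by norm_num)
  have hM0 : (M : ℚ) ≠ 0 := by
    have : M ≠ 0 := fun h ↦ hM3 (h ▸ dvd_zero 3); exact_mod_cast this
  obtain ⟨h64v, h192v, -⟩ := padicValRat_three_consts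
  have hvY : padicValRat 3 Y₁ = 0 := by
    have hv := congrArg (padicValRat 3) h64
    rw [padicValRat.mul (by norm_num) (pow_ne_zero _ hY0), padicValRat.pow Y₁, h64v, padicValRat.of_int,
      padicValInt.eq_zero_of_not_dvd hM3] at hv
    push_cast at hv; omega
  have hvQ : padicValRat 3 ((N' : ℚ) / (192 * Y₁)) = -1 := by
    rw [padicValRat.div hN'0 (mul_ne_zero (by norm_num) hY0), padicValRat.mul (by norm_num) hY0, h192v, hvY,
      padicValRat.of_int, padicValInt.eq_zero_of_not_dvd hN'3]
    simp
  have hcert : 1 < ‖(((Y₁ - tangentSlope W 1 X₁ Y₁ / 3) / 3 : ℚ) : ℚ_[3])‖ := by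
    rw [hQ, Padic.eq_padicNorm, padicNorm.eq_zpow_of_nonzero (div_ne_zero hN'0 (mul_ne_zero (by norm_num) hY0)),
      hvQ]
    norm_num
  exact not_threeBlind_of_residue_certificate W hA hB hT hXn hYn hcert

/-! ### §3 NB₃ on the two strata -/

/-- **NB₃ on the `III` and pot.-good `III*` strata, for every globally minimal tame curve** (no datum, no optimality):
`9 ∥ N`, and `ord₃ Δ_min = 3` or (`ord₃ Δ_min = 9` and `ord₃ j ≥ 0`) ⟹ no rational `3`-torsion point of `E♮` is `3`-blind —
the body of `NoBlindThreeTorsionOptimal` on these strata.  [cite: SilvermanATAEC1994, IV.9.4 Table 4.1] -/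
theorem noBlindThreeTorsion_of_III_or_IIIstar (W : WeierstrassCurve ℚ) [W.IsElliptic] [W.IsGloballyMinimal]
    (h9 : 3 ^ 2 ∣ W.conductorNorm ℤ) (h27 : ¬ 3 ^ 3 ∣ W.conductorNorm ℤ)
    (hK : padicValInt 3 W.minimalDiscriminantInt = 3 ∨
      (padicValInt 3 W.minimalDiscriminantInt = 9 ∧ 0 ≤ padicValRat 3 W.j))
    (X₁ Y₁ : ℚ) (hT : IsShortThreeTorsion W 1 X₁ Y₁) :
    ¬ IsThreeAdicFracCube (kummerCubeSeries W 1 X₁ Y₁ PowerSeries.X) := by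
  rcases hK with h3 | ⟨h9', hj⟩
  · exact (threeBlind_iff W X₁ Y₁).not.mp (not_threeBlind_of_III W h9 h27 h3 hT)
  · exact absurd hT (not_isShortThreeTorsion_of_IIIstar W h9 h27 h9' hj X₁ Y₁)

end Summit.BirchSwinnertonDyer.BirchSwinnertonDyer.Theorems.ManinLocalTwoThree

end
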